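import Literature.AlgebraicGeometry.HodgeTheory.HypersurfaceHolomorphicFormsProofs
import Literature.AlgebraicGeometry.HodgeTheory.HypersurfaceResidueForms
import HarnessLib

/-!
# `H^{0,m} ≠ 0` for smooth hypersurfaces of degree `d ≥ m + 2`: the Kähler-free assembly

Family `hodge`, layer `Literature/AlgebraicGeometry/HodgeTheory`. The reduction
`Voisin2003_hypersurface_hodgePQ_zero_ne_bot_of` (file `HypersurfaceHolomorphicForms`) of the named
fact `Voisin2003_hypersurface_hodgePQ_zero_ne_bot` (Voisin II, Rem. 6.26: `H^{0,m} ≠ 0` in every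
Hodge model of a smooth hypersurface `Y ⊂ ℙ^{m+1}_ℂ` of degree `d ≥ m + 2`) has FIVE hypotheses,
the last being that analytifications of smooth projective varieties are Kähler
(`Motives.isKaehlerManifold_of_isAnalytification_of_isClosedImmersion`, the Fubini–Study metric —
an undischarged named fact), needed there only to feed the Kähler hypothesis of
`Voisin2002_closedForm_top_zero_not_exact`. But the tree's proof of that fact
(`Voisin2002_closedForm_top_zero_not_exact_holds`, file `HypersurfaceHolomorphicFormsProofs`:
`∫_M i^{n²} η ∧ η̄ > 0` versus Stokes) does not use the Kähler metric. This file records the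
Kähler-free statement and the resulting shorter assembly, so that the discharge of
`Voisin2003_hypersurface_hodgePQ_zero_ne_bot` depends on the algebro-geometric leaf ALONE:

* `closedForm_top_zero_not_exact` — on a compact Hausdorff complex manifold of dimension `n`
  (holomorphic atlas; NO Kähler hypothesis) a non-zero smooth closed complex `n`-form of type
  `(n,0)` is not exact. Same proof as `Voisin2002_closedForm_top_zero_not_exact_holds` (verbatim,
  minus the unused instance binder), on the same lemmas of `HypersurfaceHolomorphicFormsProofs`,
  `ComplexFormsTopType`, `FormsAlgebraWedgeProofs`, `FormIntegrationStokes`.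
* `Voisin2003_hypersurface_hodgePQ_zero_ne_bot_of_exists_holomorphicTopForm` —
  `Hartshorne1977_hypersurface_exists_holomorphicTopForm → Voisin2003_hypersurface_hodgePQ_zero_ne_bot`
  (one hypothesis: the conjugation facts are the tree's theorems `conj_mem_cclosedSmoothForms_holds`,
  `conj_mem_cexactSmoothForms_holds`, and no Kähler metric is needed).
* `Voisin2003_hypersurface_hodgePQ_zero_ne_bot_of_jacobian_of_residueForm` — chained with the
  reductions `Hartshorne1977_hypersurface_exists_holomorphicTopForm_of_geometricGenus_pos`
  (`HypersurfaceGeometricGenus`) and `Hartshorne1977_hypersurface_geometricGenus_pos_of`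
  (`HypersurfaceResidueForms`): the two remaining leaves are the Jacobian criterion
  `Hartshorne1977_smoothHypersurface_jacobian` and Griffiths' residue form
  `Voisin2003_hypersurface_residueForm`.

## References

* C. Voisin, *Hodge Theory and Complex Algebraic Geometry I* (2002), Prop. 7.5, Cor. 7.6;
  *II* (2003), §6.1.3, Rem. 6.26.
* D. Huybrechts, *Complex Geometry* (2005), Lemma 1.2.9, Cor. 1.2.3.
-/

noncomputable section

open scoped Manifold ContDiff Topology
open Set Function Filter MeasureTheory Module

namespace Literature.AlgebraicGeometry.HodgeTheory

section KaehlerFree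

variable {E : Type*} [NormedAddCommGroup E] [NormedSpace ℂ E] [FiniteDimensional ℂ E]
  {M : Type*} [TopologicalSpace M] [ChartedSpace E M]

/-- **A non-zero holomorphic form of top degree on a compact complex manifold is not exact — no
Kähler hypothesis.** For `M` a compact Hausdorff complex manifold with holomorphic atlas modelled
on `E`, `finrank ℂ E = n`, and `η` a smooth closed complex `n`-form of type `(n,0)` with `η ≠ 0`:
`η ∉ B^n(M; ℂ)`. This is `Voisin2002_closedForm_top_zero_not_exact E M` without its (unused)
`IsKaehlerManifold` binder; the proof is that of `Voisin2002_closedForm_top_zero_not_exact_holds`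
verbatim (`Ω = Re(c₀ η ∧ η̄)` is exact by the Leibniz rule and `dη̄ = 0`, so `∫_M Ω = 0` by Stokes,
while `Ω = |η(e)|² ψ₀` pointwise with `ψ₀(e, ie) = 4ⁿ > 0` makes every chart integrand
non-negative and one positive, Huybrechts Lemma 1.2.9 / Cor. 1.2.3, so `∫_M Ω > 0`).
[cite: VoisinHodgeI2002, Prop. 7.5 and Cor. 7.6 (p = n)] [cite: HuybrechtsCG2005, Lemma 1.2.9] -/
theorem closedForm_top_zero_not_exact [IsManifold 𝓘(ℂ, E) ω M] [IsManifold 𝓘(ℝ, E) ∞ M]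
    [CompactSpace M] [T2Space M] (n : ℕ) (hn : Module.finrank ℂ E = n)
    (η : Literature.Geometry.Kaehler.MForm 𝓘(ℝ, E) M ℂ n) (hηs : Literature.Geometry.Kaehler.IsSmoothForm η)
    (hηc : Literature.Geometry.Kaehler.IsClosedForm η) (hηt : Literature.NumberTheory.Transcendental.IsOfType n 0 η)
    (hη0 : η ≠ 0) : η ∉ Literature.NumberTheory.Transcendental.cexactSmoothForms E M n := by
  intro hηex
  cases n with
  | zero => exact hη0 ((Submodule.mem_bot ℂ).1 hηex)
  | succ m =>
  obtain ⟨β, hβ, rfl⟩ := exists_eq_mextDeriv_of_mem_cexactSmoothForms hηex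
  classical
  -- measurable structure and real dimension of the model
  letI : MeasurableSpace E := borel E
  haveI : BorelSpace E := ⟨rfl⟩
  haveI hfact : Fact (finrank ℝ E = (m + 1) + (m + 1)) :=
    ⟨by rw [finrank_real_of_complex, hn, two_mul]⟩
  -- notation
  set mb := Literature.NumberTheory.Transcendental.modelBasis E ((m + 1) + (m + 1)) with hmb
  set ρ := Literature.NumberTheory.Transcendental.chartPartitionOfUnity 𝓘(ℝ, E) M with hρ
  have hηs' : Literature.Geometry.Kaehler.IsSmoothForm (Literature.Geometry.Kaehler.mextDeriv β) := hηs
  have hηcs : Literature.Geometry.Kaehler.IsSmoothForm (Literature.Geometry.Kaehler.mextDeriv β).conj :=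
    Literature.NumberTheory.Transcendental.isSmoothForm_conj hηs'
  -- a complex basis, the reference top form `ψ₀ = Re(c₀ det ∧ conj det)` and the orientation
  obtain ⟨e⟩ : Nonempty (Module.Basis (Fin (m + 1)) ℂ E) := ⟨Module.finBasisOfFinrankEq ℂ E hn⟩
  obtain ⟨c₀, hc₀⟩ : ∃ c₀ : ℂ, c₀ = starRingEnd ℂ ((-2 * Complex.I) ^ (m + 1)) := ⟨_, rfl⟩
  obtain ⟨ψ₀, hψ₀⟩ : ∃ ψ₀ : E [⋀^Fin ((m + 1) + (m + 1))]→L[ℝ] ℝ,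
      ψ₀ = Complex.reCLM.compContinuousAlternatingMap
        (c₀ • ((Literature.NumberTheory.Transcendental.cdetL e).wedge
          ((Complex.conjCLE : ℂ →L[ℝ] ℂ).compContinuousAlternatingMap
            (Literature.NumberTheory.Transcendental.cdetL e)))) := ⟨_, rfl⟩
  have hψ₀b₀ : 0 < ψ₀ (Fin.append e (fun j ↦ Complex.I • e j)) := by
    rw [hψ₀, hc₀]
    exact Literature.NumberTheory.Transcendental.reCLM_wedge_conj_cdetL_apply_append_pos e
  have hψ₀ne : ψ₀.toAlternatingMap ≠ 0 := fun h ↦ by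
    have : ψ₀ (Fin.append e (fun j ↦ Complex.I • e j)) = 0 := by
      rw [← ContinuousAlternatingMap.coe_toAlternatingMap, h, AlternatingMap.zero_apply]
    exact hψ₀b₀.ne' this
  have hψ₀mb : ψ₀ mb ≠ 0 := apply_basis_ne_zero_of_ne_zero mb hψ₀ne
  obtain ⟨o₀, ho₀⟩ : ∃ o₀ : Orientation ℝ E (Fin ((m + 1) + (m + 1))),
      o₀ = rayOfNeZero ℝ _ hψ₀ne := ⟨_, rfl⟩
  have ho : Literature.NumberTheory.Transcendental.IsContinuousOrientation (I := 𝓘(ℝ, E)) (M := M)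
      (fun _ ↦ o₀) := isContinuousOrientation_const o₀
  obtain ⟨r, hr, hrψ⟩ : ∃ r : ℝ, 0 < r ∧ o₀.someVector = r • ψ₀.toAlternatingMap :=
    ((ray_eq_iff (Module.Ray.someVector_ne_zero o₀) hψ₀ne).1
      (by rw [Module.Ray.someVector_ray, ho₀])).exists_pos_right
        (Module.Ray.someVector_ne_zero o₀) hψ₀ne
  -- the real top form `Ω = Re(c₀ · η ∧ η̄)`
  obtain ⟨Ω, hΩ⟩ : ∃ Ω : Literature.Geometry.Kaehler.MForm 𝓘(ℝ, E) M ℝ ((m + 1) + (m + 1)),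
      Ω = (c₀ • ((Literature.Geometry.Kaehler.mextDeriv β).wedge
        (Literature.Geometry.Kaehler.mextDeriv β).conj)).re := ⟨_, rfl⟩
  have hΩs : Literature.Geometry.Kaehler.IsSmoothForm Ω := by
    rw [hΩ]
    exact ((Literature.NumberTheory.Transcendental.IsSmoothFormWedge_holds 𝓘(ℝ, E) M ℂ hηs'
      hηcs).smul_complex c₀).re
  -- pointwise: `Ω x = |η x (e)|² ψ₀`
  have hΩx : ∀ (x : M) (v : Fin ((m + 1) + (m + 1)) → E),
      Ω x v = Complex.normSq (Literature.Geometry.Kaehler.mextDeriv β x e) * ψ₀ v := by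
    intro x v
    have hw := hηt.apply_eq_smul_cdetL e x
    have key := congrArg (fun w : E [⋀^Fin ((m + 1) + (m + 1))]→L[ℝ] ℝ ↦ w v)
      (Literature.NumberTheory.Transcendental.reCLM_wedge_conj_smul_cdetL e c₀
        (Literature.Geometry.Kaehler.mextDeriv β x e))
    simp only [ContinuousAlternatingMap.smul_apply, smul_eq_mul] at key
    rw [hΩ, hψ₀]
    refine Eq.trans ?_ key
    exact congrArg (fun φ : E [⋀^Fin (m + 1)]→L[ℝ] ℂ ↦
      (Complex.reCLM.compContinuousAlternatingMap (c₀ • (φ.wedge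
        ((Complex.conjCLE : ℂ →L[ℝ] ℂ).compContinuousAlternatingMap φ)))) v) hw
  -- exactness of `Ω`: Leibniz and `dη̄ = 0`
  have hconj0 : Literature.Geometry.Kaehler.mextDeriv (Literature.Geometry.Kaehler.mextDeriv β).conj = 0 := by
    rw [Literature.NumberTheory.Transcendental.mextDeriv_conj_holds]
    rw [show Literature.Geometry.Kaehler.mextDeriv (Literature.Geometry.Kaehler.mextDeriv β) = 0 from hηc]
    exact Literature.Geometry.Kaehler.MForm.conj_zero
  have hL := Literature.NumberTheory.Transcendental.MextDerivWedge_holds 𝓘(ℝ, E) M ℂ hβ hηcs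
  rw [hconj0, Literature.Geometry.Kaehler.MForm.wedge_zero, smul_zero, add_zero] at hL
  have hΩex : Ω ∈ Literature.Geometry.Kaehler.exactSmoothForms 𝓘(ℝ, E) M ℝ ((m + 1) + (m + 1)) := by
    have h1 : Ω.castDeg (Nat.add_right_comm m 1 (m + 1)) =
        (Literature.Geometry.Kaehler.mextDeriv
          (c₀ • β.wedge (Literature.Geometry.Kaehler.mextDeriv β).conj)).re := by
      rw [Literature.NumberTheory.Transcendental.mextDeriv_smul_complex_holds, hL, hΩ]
      rfl
    have h2 : Ω.castDeg (Nat.add_right_comm m 1 (m + 1)) ∈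
        Literature.Geometry.Kaehler.exactSmoothForms 𝓘(ℝ, E) M ℝ (m + (m + 1) + 1) := by
      rw [h1]
      exact re_mextDeriv_mem_exactSmoothForms
        ((Literature.NumberTheory.Transcendental.IsSmoothFormWedge_holds 𝓘(ℝ, E) M ℂ hβ hηcs).smul_complex
          c₀)
    have h3 := Literature.NumberTheory.Transcendental.castDeg_mem_exactSmoothForms
      (Nat.add_right_comm m 1 (m + 1)).symm h2
    rwa [Literature.Geometry.Kaehler.MForm.castDeg_castDeg, Literature.Geometry.Kaehler.MForm.castDeg_rfl]
      at h3
  -- Stokes: `∫ Ω = 0`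
  have h0 : Ω.integral (fun _ ↦ o₀) = 0 :=
    Literature.Geometry.Kaehler.MForm.integral_eq_zero_of_mem_exactSmoothForms_holds
      (o := fun _ ↦ o₀) ho hΩex
  -- the chart integrands of `∫ Ω`, at the chart point of `z ∈ source`
  have hsv : Real.sign (o₀.someVector mb) = Real.sign (ψ₀ mb) := by
    rw [hrψ, AlternatingMap.smul_apply, ContinuousAlternatingMap.coe_toAlternatingMap, smul_eq_mul,
      Literature.NumberTheory.Transcendental.real_sign_mul, Real.sign_of_pos hr, one_mul]
  have hformula : ∀ (i z : M), z ∈ (extChartAt 𝓘(ℝ, E) i).source →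
      Literature.NumberTheory.Transcendental.chartSign (I := 𝓘(ℝ, E)) (M := M) (fun _ ↦ o₀) i
          (extChartAt 𝓘(ℝ, E) i z) *
        ρ i ((extChartAt 𝓘(ℝ, E) i).symm (extChartAt 𝓘(ℝ, E) i z)) *
          Ω.inChart i (extChartAt 𝓘(ℝ, E) i z) mb =
      ρ i z * LinearMap.det (tangentCoordChange 𝓘(ℝ, E) i z z : E →ₗ[ℝ] E) *
        Complex.normSq (Literature.Geometry.Kaehler.mextDeriv β z e) * |ψ₀ mb| := by
    intro i z hz
    have hin : Ω.inChart i (extChartAt 𝓘(ℝ, E) i z) mb =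
        LinearMap.det (tangentCoordChange 𝓘(ℝ, E) i z z : E →ₗ[ℝ] E) * Ω z mb := by
      rw [Literature.Geometry.Kaehler.MForm.inChart_eq_of_mem_target _
          ((extChartAt 𝓘(ℝ, E) i).map_source hz),
        (extChartAt 𝓘(ℝ, E) i).left_inv hz, ContinuousAlternatingMap.compContinuousLinearMap_apply]
      exact Literature.NumberTheory.Transcendental.ContinuousAlternatingMap.apply_comp_eq_det_mul mb _ _ _
    rw [chartSign_const_extChartAt o₀ hz, hsv, hin, (extChartAt 𝓘(ℝ, E) i).left_inv hz, hΩx z mb,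
      ← Literature.NumberTheory.Transcendental.real_sign_mul_self (ψ₀ mb)]
    ring
  -- positivity: `0 < ∫ Ω`
  have hpos : 0 < Ω.integral (fun _ ↦ o₀) := by
    refine integral_pos_of_chartIntegrand_nonneg ho hΩs (fun i y hy ↦ ?_) ?_
    · have hz : (extChartAt 𝓘(ℝ, E) i).symm y ∈ (extChartAt 𝓘(ℝ, E) i).source :=
        (extChartAt 𝓘(ℝ, E) i).map_target hy
      rw [← (extChartAt 𝓘(ℝ, E) i).right_inv hy, hformula i _ hz]
      exact mul_nonneg (mul_nonneg (mul_nonneg (ρ.nonneg i _)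
        (det_tangentCoordChange_self_pos (M := M) i hz).le) (Complex.normSq_nonneg _)) (abs_nonneg _)
    · obtain ⟨x₀, hx₀⟩ : ∃ x₀, Literature.Geometry.Kaehler.mextDeriv β x₀ ≠ 0 := Function.ne_iff.1 hη0
      have hsum := ρ.sum_eq_one (Set.mem_univ x₀)
      obtain ⟨i₀, hi₀⟩ : ∃ i₀, ρ i₀ x₀ ≠ 0 := by
        by_contra h
        push Not at h
        rw [finsum_congr h, finsum_zero] at hsum
        exact zero_ne_one hsum
      have hρpos : 0 < ρ i₀ x₀ := lt_of_le_of_ne (ρ.nonneg i₀ x₀) (Ne.symm hi₀)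
      have hxs : x₀ ∈ (extChartAt 𝓘(ℝ, E) i₀).source := by
        rw [extChartAt_source]
        exact Literature.NumberTheory.Transcendental.chartPartitionOfUnity_isSubordinate i₀
          (subset_tsupport _ hi₀)
      have hηe : Literature.Geometry.Kaehler.mextDeriv β x₀ e ≠ 0 := by
        intro h0e
        apply hx₀
        have hw := hηt.apply_eq_smul_cdetL e x₀
        rw [h0e] at hw
        exact hw.trans (zero_smul ℂ _)
      refine ⟨i₀, extChartAt 𝓘(ℝ, E) i₀ x₀, (extChartAt 𝓘(ℝ, E) i₀).map_source hxs, ?_⟩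
      rw [hformula i₀ _ hxs]
      exact mul_pos (mul_pos (mul_pos hρpos (det_tangentCoordChange_self_pos (M := M) i₀ hxs))
        (Complex.normSq_pos.2 hηe)) (abs_pos.2 hψ₀mb)
  exact absurd h0 hpos.ne'


end KaehlerFree

/-! ### The assembly with one hypothesis -/

section Assembly

/-- **`H^{0,m} ≠ 0` for smooth hypersurfaces of degree `d ≥ m + 2`, from the existence of a non-zero
holomorphic `m`-form alone** (Voisin II, Rem. 6.26 with Cor. 6.12 at `p = 1`): the Kähler-free
form of `Voisin2003_hypersurface_hodgePQ_zero_ne_bot_of`. For `η` given by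
`Hartshorne1977_hypersurface_exists_holomorphicTopForm` on the (compact) carrier of the Hodge
model, `η` is not exact (`closedForm_top_zero_not_exact`), hence neither is `η̄`
(`conj_mem_cexactSmoothForms_holds`, `\overline{η̄} = η`), and `η̄` is a closed `(0,m)`-form
(`conj_mem_cclosedSmoothForms_holds`, `IsOfType.conj`), so its class is a non-zero element of
`H^{0,m}` (`hodgePQ_ne_bot_of_not_mem_cexactSmoothForms`), i.e. `A.hodgePQ m 0 m ≠ ⊥`
(`HodgeModel.hodgePQ_eq_bot_iff`). [cite: VoisinHodgeII2003, Rem. 6.26 and Cor. 6.12]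
[cite: VoisinHodgeI2002, Cor. 7.6] -/
theorem Voisin2003_hypersurface_hodgePQ_zero_ne_bot_of_exists_holomorphicTopForm
    (h₁ : Hartshorne1977_hypersurface_exists_holomorphicTopForm) :
    Voisin2003_hypersurface_hodgePQ_zero_ne_bot := by
  intro m d hm hd Y hY A
  obtain ⟨η, hηs, hηc, hηt, hη0⟩ := h₁ m d hm hd Y hY A
  haveI : CompactSpace A.carrier := A.compactSpace_carrier hY.1
  have hne : η ∉ Literature.NumberTheory.Transcendental.cexactSmoothForms A.model A.carrier m :=
    closedForm_top_zero_not_exact m A.isAnalytification.finrank_eq η hηs hηc hηt hη0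
  have hcc : η.conj ∈ Literature.NumberTheory.Transcendental.cclosedSmoothForms A.model A.carrier m :=
    Literature.NumberTheory.Transcendental.conj_mem_cclosedSmoothForms_holds
      (Literature.NumberTheory.Transcendental.mem_cclosedSmoothForms hηs hηc)
  have hce : η.conj ∉ Literature.NumberTheory.Transcendental.cexactSmoothForms A.model A.carrier m := by
    intro h
    have h' := Literature.NumberTheory.Transcendental.conj_mem_cexactSmoothForms_holds h
    rw [Literature.Geometry.Kaehler.MForm.conj_conj] at h'
    exact hne h'
  intro hbot
  rw [A.hodgePQ_eq_bot_iff] at hbot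
  exact hodgePQ_ne_bot_of_not_mem_cexactSmoothForms hcc hηt.conj hce hbot

/-- **What remains**: chaining with the tree's reductions
`Hartshorne1977_hypersurface_exists_holomorphicTopForm_of_geometricGenus_pos`
(`HypersurfaceGeometricGenus`: a form holomorphic in charts is smooth, closed and of type `(m,0)`)
and `Hartshorne1977_hypersurface_geometricGenus_pos_of` (`HypersurfaceResidueForms`: the residue
form from the Jacobian criterion), the named fact `Voisin2003_hypersurface_hodgePQ_zero_ne_bot`
follows from the two algebro-geometric leaves `Hartshorne1977_smoothHypersurface_jacobian`
(Hartshorne I, Thm. 5.1 / Ex. 5.8) and `Voisin2003_hypersurface_residueForm` (Griffiths' residue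
`Res_Y(X_i^{d-m-2}Ω/F)`, Voisin II §6.1.3). [cite: VoisinHodgeII2003, §6.1.3 and Rem. 6.26] -/
theorem Voisin2003_hypersurface_hodgePQ_zero_ne_bot_of_jacobian_of_residueForm
    (hJ : Hartshorne1977_smoothHypersurface_jacobian) (hR : Voisin2003_hypersurface_residueForm) :
    Voisin2003_hypersurface_hodgePQ_zero_ne_bot :=
  Voisin2003_hypersurface_hodgePQ_zero_ne_bot_of_exists_holomorphicTopForm
    (Hartshorne1977_hypersurface_exists_holomorphicTopForm_of_geometricGenus_pos
      (Hartshorne1977_hypersurface_geometricGenus_pos_of hJ hR))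

end Assembly

end Literature.AlgebraicGeometry.HodgeTheory

end
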